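import Literature.LinearAlgebra.KunnethSemisimplicityCriterion
import Mathlib.LinearAlgebra.Matrix.Dual
import Mathlib.LinearAlgebra.Eigenspace.Charpoly
import Mathlib.RingTheory.Flat.Equalizer
import Mathlib.FieldTheory.IsAlgClosed.AlgebraicClosure
import HarnessLib

/-!
# Milne's semisimplicity criterion WITHOUT the split hypothesis: base change of the Künneth data to
# the algebraic closure, and descent (Kahn 2020 Th. 6.54 ⟹ / Milne 2007 Th. 1.3 in full)

Topic `LinearAlgebra`; THEOREMS ONLY (no definition, no instance, no named fact; D-0026).

B. Kahn, *Zeta and L-functions of varieties and motives* (2020) §6.14 Th. 6.54 (held, p. 132):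
«`S^d(X × X, l) ⟺ SS^i(X, l)` for all `i`»; J. S. Milne, arXiv:0709.3040 Th. 1.3 (held, p. 3–4): «If
`S^{2d}(X × X, ℓ)` is true, then every Frobenius map `π` acts semisimply on `H^*(X, ℚ_ℓ)`» — the
printed proof uses ALL eigenvalues `a` of `π`, i.e. it is an argument over `ℚ̄_ℓ`.  Row g39-#5
(`KunnethSemisimplicityCriterion`) formalised the argument over a field in which the characteristic
polynomial splits, and the descent of semisimplicity along a field extension.  This file supplies the
BASE CHANGE of the data and concludes over an ARBITRARY coefficient field `K`:

* §1 the characteristic polynomial of the dual map (`charpoly_dualMap`) and of the ADJOINT: for a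
  perfect pairing `B` with `B(Fv, ψw) = B(v, w)`, `ψ` is conjugate to the dual map of `F⁻¹`, so
  `charpoly ψ = charpoly F⁻¹` (`charpoly_eq_charpoly_symm_of_pairing`) — the form of Milne's «by
  Poincaré duality `1/a` occurs as an eigenvalue on `H^{2d−r}`» that survives extension of scalars;
  the eigenvalue transfer from such an identity (`eigenspace_inv_ne_bot_of_charpoly_eq`).
* §2 base change along a field extension `L/K`: kernels (`ker_baseChange`, flatness), injectivity
  (`baseChange_injective`), the `S` condition `Ker(Φ − 1) ∩ (Φ − 1)M = 0`
  (`ker_inf_range_eq_bot_baseChange`, through «`Ker(Φ−1)² = Ker(Φ−1)`»), and the Künneth product: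
  a bilinear `κ_L` on `V_L × W_L` with `κ_L(a ⊗ v, b ⊗ w) = ab ⊗ κ(v, w)` exists
  (`exists_bilin_baseChange`), intertwines `F_L ⊗ ψ_L` with `Φ_L` (`bilin_baseChange_equivariant`) and
  has no zero divisors when `V ⊗ W → M` is injective (`bilin_baseChange_no_zero_divisors`).
* §3 **MAIN THEOREM `isSemisimple_of_kunneth_pairing`**: over ANY field `K`, `F ∈ End V` with an
  invariant perfect pairing `B(Fv, ψw) = B(v, w)`, an injective Künneth product
  `V ⊗ W ↪ M` intertwining `F ⊗ ψ` with `Φ`, and `Ker(Φ − 1) ∩ (Φ − 1)M = 0`, IS SEMISIMPLE — base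
  change to `K̄`, row g39-#5's `isSemisimple_of_kunneth_of_splits`, descent.

What this file does NOT do: the application to the abstract Weil cohomology `E` (the sequel row);
nothing here mentions cohomology.

## Provenance

Lane `lit-hodgefound` (summit `HodgeConjecture`, Track 2 foundations library, Layer B: motives),
seat `lit-hodgefound-p29` (literature-prover, generation 39, row g39-#6).
-/

open Module Module.End Polynomial
open scoped TensorProduct

namespace Literature.LinearAlgebra

/-! ## §1 Characteristic polynomial of the dual map and of the adjoint; eigenvalue transfer -/

section Adjoint

variable {K : Type*} [Field K]
variable {V : Type*} [AddCommGroup V] [Module K V]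
variable {W : Type*} [AddCommGroup W] [Module K W]

/-- **`charpoly (f^∨) = charpoly f`** (the matrix of the dual map in dual bases is the transpose;
Mathlib has the determinant version `LinearMap.det_dualMap`). [cite: Milne2007TateFiniteFieldsAIM, Th. 1.3 (proof, «by Poincaré duality»)] -/
theorem charpoly_dualMap [FiniteDimensional K V] (f : Module.End K V) :
    (f.dualMap : Module.End K (Module.Dual K V)).charpoly = f.charpoly := by
  classical
  let b := Module.Free.chooseBasis K V
  haveI : Fintype (Module.Free.ChooseBasisIndex K V) := Module.Free.ChooseBasisIndex.fintype K V
  rw [← LinearMap.charpoly_toMatrix f b,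
    ← LinearMap.charpoly_toMatrix (f.dualMap : Module.End K (Module.Dual K V)) b.dualBasis,
    LinearMap.dualMap_def, LinearMap.toMatrix_transpose, Matrix.charpoly_transpose]

/-- **The adjoint identity `charpoly ψ = charpoly F⁻¹`** for a perfect pairing `B : V × W → K` with
`B(Fv, ψw) = B(v, w)`: `ψ` is conjugate, through `W ≅ V^∨` (`w ↦ B(·, w)`), to the dual map of `F⁻¹`
(`F` is invertible by the tree's `InvariantPairing.bijective_left`).  Milne: «if `a` occurs as an
eigenvalue of `π` on `H^r`, then `1/a` occurs as an eigenvalue of `π` on `H^{2d−r}(d)` (by Poincaré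
duality)», in a form stable under extension of scalars. [cite: Milne2007TateFiniteFieldsAIM, Th. 1.3 (proof)] -/
theorem charpoly_eq_charpoly_symm_of_pairing [FiniteDimensional K V] [FiniteDimensional K W]
    (B : V →ₗ[K] W →ₗ[K] K) [B.IsPerfPair] {F : Module.End K V} {ψ : Module.End K W}
    (h : ∀ v w, B (F v) (ψ w) = B v w) :
    ψ.charpoly =
      ((LinearEquiv.ofBijective F (InvariantPairing.bijective_left B h)).symm : V →ₗ[K] V).charpoly := by
  set G := LinearEquiv.ofBijective F (InvariantPairing.bijective_left B h) with hG
  set e : W ≃ₗ[K] Module.Dual K V :=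
    LinearEquiv.ofBijective B.flip (LinearMap.IsPerfPair.bijective_right B) with he
  have key : ψ = e.symm.conj (((G.symm : V →ₗ[K] V)).dualMap : Module.End K (Module.Dual K V)) := by
    apply LinearMap.ext
    intro w
    rw [LinearEquiv.conj_apply, LinearMap.comp_apply, LinearMap.comp_apply, LinearEquiv.coe_coe,
      LinearEquiv.coe_coe, LinearEquiv.symm_symm]
    apply e.injective
    rw [e.apply_symm_apply]
    apply LinearMap.ext
    intro v
    rw [LinearMap.dualMap_apply]
    change B.flip (ψ w) v = B.flip w (G.symm v)
    rw [LinearMap.flip_apply, LinearMap.flip_apply]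
    conv_lhs => rw [← G.apply_symm_apply v]
    exact h (G.symm v) w
  rw [key, LinearEquiv.charpoly_conj, charpoly_dualMap]

end Adjoint

section Transfer

variable {L : Type*} [Field L]
variable {V : Type*} [AddCommGroup V] [Module L V]
variable {W : Type*} [AddCommGroup W] [Module L W]

/-- **Eigenvalue transfer from `charpoly ψ = charpoly G`, `G F = 1`**: if `μ ≠ 0` is an eigenvalue of
`F` then `μ⁻¹` is an eigenvalue of `G`, hence a root of `charpoly G = charpoly ψ`, hence an eigenvalue
of `ψ`. [cite: Milne2007TateFiniteFieldsAIM, Th. 1.3 (proof)] -/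
theorem eigenspace_inv_ne_bot_of_charpoly_eq [FiniteDimensional L V] [FiniteDimensional L W]
    {F G : Module.End L V} {ψ : Module.End L W} (hGF : G * F = 1) (hψ : ψ.charpoly = G.charpoly)
    {μ : L} (hμ : μ ≠ 0) (hF : F.eigenspace μ ≠ ⊥) : ψ.eigenspace μ⁻¹ ≠ ⊥ := by
  obtain ⟨v, hv, hv0⟩ := (Submodule.ne_bot_iff _).mp hF
  have hFv : F v = μ • v := Module.End.mem_eigenspace_iff.mp hv
  have hGv : G v = μ⁻¹ • v := by
    have h1 : G (F v) = v := by rw [← Module.End.mul_apply, hGF, Module.End.one_apply]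
    rw [hFv, map_smul] at h1
    calc G v = μ⁻¹ • (μ • G v) := by rw [smul_smul, inv_mul_cancel₀ hμ, one_smul]
      _ = μ⁻¹ • v := by rw [h1]
  have hG : G.HasEigenvalue μ⁻¹ :=
    Module.End.hasEigenvalue_of_hasEigenvector ⟨Module.End.mem_eigenspace_iff.mpr hGv, hv0⟩
  rw [Module.End.hasEigenvalue_iff_isRoot_charpoly, ← hψ,
    ← Module.End.hasEigenvalue_iff_isRoot_charpoly] at hG
  exact Module.End.hasEigenvalue_iff.mp hG

end Transfer

/-! ## §2 Base change along a field extension -/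

section BaseChange

variable {K : Type*} [Field K]
variable {V : Type*} [AddCommGroup V] [Module K V]
variable {W : Type*} [AddCommGroup W] [Module K W]
variable {M : Type*} [AddCommGroup M] [Module K M]
variable (L : Type*) [Field L] [Algebra K L]

/-- **Kernels commute with extension of scalars**: `Ker(f_L) = (Ker f)_L` (flatness of `L/K`; Mathlib
`Module.Flat.ker_lTensor_eq`). [cite: GortzWedhorn2020, Remark 6.12 (2)–(3)] -/
theorem ker_baseChange (f : V →ₗ[K] W) :
    LinearMap.ker (f.baseChange L) = (LinearMap.ker f).baseChange L :=
  Module.Flat.ker_lTensor_eq L L f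

/-- **Extension of scalars preserves injectivity** (flatness). [cite: GortzWedhorn2020, Remark 6.12 (2)–(3)] -/
theorem baseChange_injective {f : V →ₗ[K] W} (hf : Function.Injective f) :
    Function.Injective (f.baseChange L) := by
  have h := Module.Flat.lTensor_preserves_injective_linearMap (M := L) f hf
  rwa [← LinearMap.baseChange_eq_ltensor] at h

/-- **The `S` condition survives extension of scalars**: `Ker(Φ − 1) ∩ (Φ − 1)M = 0 ⟹
Ker(Φ_L − 1) ∩ (Φ_L − 1)M_L = 0` (through the kernel form `Ker(Φ − 1)² = Ker(Φ − 1)` of the tree's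
`InvariantPairing.ker_inf_range_eq_bot_iff_ker_sq_eq`, and `Ker` commutes with base change).
[cite: Kahn2020, §6.14 Th. 6.54] [cite: GortzWedhorn2020, Remark 6.12 (2)–(3)] -/
theorem ker_inf_range_eq_bot_baseChange (Φ : Module.End K M)
    (hS : LinearMap.ker (Φ - 1) ⊓ LinearMap.range (Φ - 1) = ⊥) :
    LinearMap.ker (Φ.baseChange L - 1) ⊓ LinearMap.range (Φ.baseChange L - 1) = ⊥ := by
  rw [InvariantPairing.ker_inf_range_eq_bot_iff_ker_sq_eq] at hS ⊢
  have h1 : Φ.baseChange L - 1 = (Φ - 1).baseChange L := by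
    rw [LinearMap.baseChange_sub, LinearMap.baseChange_one]
  rw [h1, ← LinearMap.baseChange_pow, ker_baseChange, ker_baseChange, hS]

/-- **Base change of a bilinear map**: there is an `L`-bilinear `κ_L : V_L × W_L → M_L` with
`κ_L(a ⊗ v, b ⊗ w) = ab ⊗ κ(v, w)` (the base change of `V ⊗ W → M` composed with
`(V ⊗ W)_L ≅ V_L ⊗_L W_L`). [cite: GortzWedhorn2020, Remark 6.12 (2)–(3)] -/
theorem exists_bilin_baseChange (κ : V →ₗ[K] W →ₗ[K] M) :
    ∃ κ' : L ⊗[K] V →ₗ[L] L ⊗[K] W →ₗ[L] L ⊗[K] M,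
      ∀ (a b : L) (v : V) (w : W), κ' (a ⊗ₜ[K] v) (b ⊗ₜ[K] w) = (a * b) ⊗ₜ[K] κ v w := by
  refine ⟨TensorProduct.curry ((TensorProduct.lift κ).baseChange L ∘ₗ
    (TensorProduct.AlgebraTensorModule.distribBaseChange K L V W).symm.toLinearMap), fun a b v w ↦ ?_⟩
  rw [TensorProduct.curry_apply, LinearMap.comp_apply, LinearEquiv.coe_toLinearMap,
    TensorProduct.AlgebraTensorModule.distribBaseChange_symm_tmul, LinearMap.baseChange_tmul,
    TensorProduct.lift.tmul]

/-- **The base-changed Künneth product intertwines `F_L ⊗ ψ_L` with `Φ_L`** if `κ` intertwines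
`F ⊗ ψ` with `Φ`. [cite: Milne2007TateFiniteFieldsAIM, Th. 1.3 (proof, «Künneth formula»)] -/
theorem bilin_baseChange_equivariant (κ : V →ₗ[K] W →ₗ[K] M)
    (κ' : L ⊗[K] V →ₗ[L] L ⊗[K] W →ₗ[L] L ⊗[K] M)
    (hκ' : ∀ (a b : L) (v : V) (w : W), κ' (a ⊗ₜ[K] v) (b ⊗ₜ[K] w) = (a * b) ⊗ₜ[K] κ v w)
    {F : Module.End K V} {ψ : Module.End K W} {Φ : Module.End K M}
    (hκ : ∀ a b, κ (F a) (ψ b) = Φ (κ a b)) (x : L ⊗[K] V) (y : L ⊗[K] W) :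
    κ' (F.baseChange L x) (ψ.baseChange L y) = Φ.baseChange L (κ' x y) := by
  induction x using TensorProduct.induction_on with
  | zero => simp only [map_zero, LinearMap.zero_apply]
  | add x₁ x₂ h₁ h₂ => simp only [map_add, LinearMap.add_apply, h₁, h₂]
  | tmul a v =>
    induction y using TensorProduct.induction_on with
    | zero => simp only [map_zero]
    | add y₁ y₂ h₁ h₂ => simp only [map_add, h₁, h₂]
    | tmul b w =>
      rw [LinearMap.baseChange_tmul, LinearMap.baseChange_tmul, hκ', hκ, hκ', LinearMap.baseChange_tmul]

/-- Over a field, `x ⊗ y = 0` forces `x = 0` or `y = 0` (test with a linear form `φ` with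
`φ(x) ≠ 0`: `(φ ⊗ 1)(x ⊗ y) = φ(x) y`). [folklore] -/
private theorem eq_zero_or_eq_zero_of_tmul_eq_zero {L : Type*} [Field L] {A B : Type*}
    [AddCommGroup A] [Module L A] [AddCommGroup B] [Module L B] {x : A} {y : B}
    (h : x ⊗ₜ[L] y = 0) : x = 0 ∨ y = 0 := by
  by_contra hne
  push Not at hne
  obtain ⟨hx, hy⟩ := hne
  obtain ⟨φ, hφ⟩ : ∃ φ : Module.Dual L A, φ x ≠ 0 := by
    by_contra hall
    push Not at hall
    exact hx ((Module.forall_dual_apply_eq_zero_iff L x).mp hall)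
  have h1 : TensorProduct.lid L B (φ.rTensor B (x ⊗ₜ[L] y)) = φ x • y := by
    rw [LinearMap.rTensor_tmul, TensorProduct.lid_tmul]
  rw [h, map_zero, map_zero] at h1
  exact smul_ne_zero hφ hy h1.symm

/-- **The base-changed Künneth product has no zero divisors** when `V ⊗ W → M` is injective:
`κ_L(x, y) = 0 ⟹ x = 0 ∨ y = 0` (the induced `V_L ⊗_L W_L → M_L` is the base change of `V ⊗ W → M`
up to `(V ⊗ W)_L ≅ V_L ⊗_L W_L`, injective by flatness).
[cite: Milne2007TateFiniteFieldsAIM, Th. 1.3 (proof, «Künneth formula»)] [cite: GortzWedhorn2020, Remark 6.12 (2)–(3)] -/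
theorem bilin_baseChange_no_zero_divisors (κ : V →ₗ[K] W →ₗ[K] M)
    (hinj : Function.Injective (TensorProduct.lift κ))
    (κ' : L ⊗[K] V →ₗ[L] L ⊗[K] W →ₗ[L] L ⊗[K] M)
    (hκ' : ∀ (a b : L) (v : V) (w : W), κ' (a ⊗ₜ[K] v) (b ⊗ₜ[K] w) = (a * b) ⊗ₜ[K] κ v w)
    (x : L ⊗[K] V) (y : L ⊗[K] W) (h : κ' x y = 0) : x = 0 ∨ y = 0 := by
  -- the induced map on `V_L ⊗_L W_L` is `(lift κ)_L ∘ distribBaseChange⁻¹`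
  have hlift : TensorProduct.lift κ' = (TensorProduct.lift κ).baseChange L ∘ₗ
      (TensorProduct.AlgebraTensorModule.distribBaseChange K L V W).symm.toLinearMap := by
    refine TensorProduct.ext' fun x y ↦ ?_
    induction x using TensorProduct.induction_on with
    | zero => simp only [TensorProduct.zero_tmul, map_zero]
    | add x₁ x₂ h₁ h₂ => simp only [TensorProduct.add_tmul, map_add, h₁, h₂]
    | tmul a v =>
      induction y using TensorProduct.induction_on with
      | zero => simp only [TensorProduct.tmul_zero, map_zero]
      | add y₁ y₂ h₁ h₂ => simp only [TensorProduct.tmul_add, map_add, h₁, h₂]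
      | tmul b w =>
        rw [TensorProduct.lift.tmul, hκ', LinearMap.comp_apply, LinearEquiv.coe_toLinearMap,
          TensorProduct.AlgebraTensorModule.distribBaseChange_symm_tmul, LinearMap.baseChange_tmul,
          TensorProduct.lift.tmul]
  have hinj' : Function.Injective (TensorProduct.lift κ') := by
    rw [hlift, LinearMap.coe_comp, LinearEquiv.coe_toLinearMap]
    exact (baseChange_injective L hinj).comp (LinearEquiv.injective _)
  have h0 : TensorProduct.lift κ' (x ⊗ₜ[L] y) = 0 := by rw [TensorProduct.lift.tmul, h]
  exact eq_zero_or_eq_zero_of_tmul_eq_zero (hinj' (by rw [h0, map_zero]))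

end BaseChange

/-! ## §3 Milne's criterion over an arbitrary coefficient field -/

section Main

variable {K : Type*} [Field K]
variable {V : Type*} [AddCommGroup V] [Module K V]
variable {W : Type*} [AddCommGroup W] [Module K W]
variable {M : Type*} [AddCommGroup M] [Module K M]

/-- **MILNE 2007 TH. 1.3 / KAHN 2020 TH. 6.54 ⟹, IN FULL, AS LINEAR ALGEBRA OVER ANY FIELD `K`**:
let `F ∈ End V` and `ψ ∈ End W` leave a perfect pairing invariant (`B(Fv, ψw) = B(v, w)`), let
`κ : V × W → M` be a bilinear map whose linear extension `V ⊗ W → M` is injective and which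
intertwines `F ⊗ ψ` with `Φ ∈ End M`, and suppose `Ker(Φ − 1) ∩ (Φ − 1)M = 0`.  Then `F` is
SEMISIMPLE.  Proof: all data pass to `K̄` (§2, §1), where the characteristic polynomial splits and row
g39-#5's `isSemisimple_of_kunneth_of_splits` applies; semisimplicity descends
(`isSemisimple_of_isSemisimple_baseChange`). [cite: Kahn2020, §6.14 Th. 6.54]
[cite: Milne2007TateFiniteFieldsAIM, Th. 1.3] -/
theorem isSemisimple_of_kunneth_pairing [FiniteDimensional K V] [FiniteDimensional K W]
    (B : V →ₗ[K] W →ₗ[K] K) [B.IsPerfPair] (F : Module.End K V) (ψ : Module.End K W)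
    (Φ : Module.End K M) (hB : ∀ v w, B (F v) (ψ w) = B v w) (κ : V →ₗ[K] W →ₗ[K] M)
    (hκ : ∀ a b, κ (F a) (ψ b) = Φ (κ a b)) (hκinj : Function.Injective (TensorProduct.lift κ))
    (hS : LinearMap.ker (Φ - 1) ⊓ LinearMap.range (Φ - 1) = ⊥) : F.IsSemisimple := by
  let L := AlgebraicClosure K
  refine isSemisimple_of_isSemisimple_baseChange L F ?_
  have hFbij := InvariantPairing.bijective_left B hB
  set G : Module.End K V := ((LinearEquiv.ofBijective F hFbij).symm : V →ₗ[K] V) with hG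
  have hGF : G * F = 1 :=
    LinearMap.ext fun v ↦ (LinearEquiv.ofBijective F hFbij).symm_apply_apply v
  have hcharK : ψ.charpoly = G.charpoly := charpoly_eq_charpoly_symm_of_pairing B hB
  have hGF_L : G.baseChange L * F.baseChange L = 1 := by
    rw [← LinearMap.baseChange_mul, hGF, LinearMap.baseChange_one]
  have hchar_L : (ψ.baseChange L).charpoly = (G.baseChange L).charpoly := by
    rw [LinearMap.charpoly_baseChange, LinearMap.charpoly_baseChange, hcharK]
  obtain ⟨κ', hκ'⟩ := exists_bilin_baseChange L κ
  exact isSemisimple_of_kunneth_of_splits (F.baseChange L) (ψ.baseChange L) (Φ.baseChange L)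
    (baseChange_injective L hFbij.1)
    (fun μ hμ hne ↦ eigenspace_inv_ne_bot_of_charpoly_eq hGF_L hchar_L hμ hne) κ'
    (bilin_baseChange_equivariant L κ κ' hκ' hκ)
    (bilin_baseChange_no_zero_divisors L κ hκinj κ' hκ')
    (ker_inf_range_eq_bot_baseChange L Φ hS) (IsAlgClosed.splits _)

/-- The same with the conclusion for every `μ ∈ K` spelled out: every generalized eigenspace of `F` is
the eigenspace (a semisimple endomorphism over a field is finitely semisimple).
[cite: Kahn2020, §6.14 Th. 6.54] [cite: Milne2007TateFiniteFieldsAIM, Th. 1.3] -/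
theorem maxGenEigenspace_eq_eigenspace_of_kunneth_pairing' [FiniteDimensional K V]
    [FiniteDimensional K W] (B : V →ₗ[K] W →ₗ[K] K) [B.IsPerfPair] (F : Module.End K V)
    (ψ : Module.End K W) (Φ : Module.End K M) (hB : ∀ v w, B (F v) (ψ w) = B v w)
    (κ : V →ₗ[K] W →ₗ[K] M) (hκ : ∀ a b, κ (F a) (ψ b) = Φ (κ a b))
    (hκinj : Function.Injective (TensorProduct.lift κ))
    (hS : LinearMap.ker (Φ - 1) ⊓ LinearMap.range (Φ - 1) = ⊥) (μ : K) :
    F.maxGenEigenspace μ = F.eigenspace μ :=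
  (isSemisimple_of_kunneth_pairing B F ψ Φ hB κ hκ hκinj hS).isFinitelySemisimple.maxGenEigenspace_eq_eigenspace μ

end Main

end Literature.LinearAlgebra
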